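import Literature.Probability.RandomPlanarGeometry.HexSAWEndpointRatioRate
import Literature.Probability.RandomPlanarGeometry.HexSAWBrickWallPolygonGrowth
import HarnessLib

/-!
# The polygon two-step ratio and its upper rate on `ℍ` in the polygon-count normalisation `p_N(ℍ)`:
# `p_{2m+4}(ℍ)/p_{2m+2}(ℍ) → 2 + √2` and `≤ 2 + √2 + K·m^{-1/4}` (Madras–Slade Theorem 7.3.4 (c) / (7.5.2) on `ℍ`, verbatim shape)

Topic `Literature/Probability/RandomPlanarGeometry` (lane «pcv-sawmu», a-p4 g7; sequel of `HexSAWPolygonRatio.lean` /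
`HexSAWEndpointRatioRate.lean` — `HV.hexPolygonRatioTwo`, `hexPolygonRatioTwo_upperRate` over the fixed-endpoint family
`HV.endFin nb2 N` — restated through a-p6 g6's polygon count `hexPolygonCount N := HexBW.endAtCount (N − 1) e₀` of
`HexSAWBrickWallPolygonGrowth.lean` (`μ_polygon(ℍ) = μ_ℍ`: `tendsto_hexPolygonCount_rpow`)).

Source: N. Madras, G. Slade, *The Self-Avoiding Walk* (1993), Theorem 7.3.4 (c) p. 248: "`lim_{N→∞} q_{2N+2}/q_{2N} = μ²`", and §7.5
(7.5.2) p. 255 (the rate, Kesten 1963); printed and proved for `ℤ^d` only; `ℍ`: nothing printed for polygon-count ratios (lane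
lit-1 cells 2026-08-22T23:54:47Z / 2026-08-23T01:23:00Z). Label (lane, lead g9 r84): «CONSOLIDATION — Kesten's/M–S's `ℤ^d` two-step
ratio architecture carried to the honeycomb lattice with `μ_ℍ² = 2+√2`; first written proof for `ℍ` + first kernel text; no hypotheses».

## Contents (namespace `Literature.Probability.RandomPlanarGeometry.SAW.HV`; all PROVED, NO hypotheses, axioms standard)

* `hexPolygonCount_eq_card_endFin : hexPolygonCount (N + 1) = #E_N(nb2)` (`card_endFin_eq_card_bw`, `hvToBW nb2 = e₀`);
* **`hexPolygonCountRatioTwo : Tendsto (fun m => (hexPolygonCount (2m+4) : ℝ) / hexPolygonCount (2m+2)) atTop (𝓝 (2 + √2))`**;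
* **`hexPolygonCountRatioTwo_upperRate : ∃ K m₁, ∀ m ≥ m₁, p_{2m+4}(ℍ)/p_{2m+2}(ℍ) − (2+√2) ≤ K·m^{−1/4}`**.
-/

noncomputable section

open Finset Filter Topology Literature.Probability.LatticeModels SimpleGraph

namespace Literature.Probability.RandomPlanarGeometry.SAW.HV

/-- The lane's polygon count in terms of the fixed-endpoint family: `hexPolygonCount (N+1) = #E_N(nb2)` (`hvToBW nb2 = e₀`).
[cite: MadrasSlade1993, §3.2, (3.2.1) p. 63] -/
theorem hexPolygonCount_eq_card_endFin (N : ℕ) : hexPolygonCount (N + 1) = #(endFin nb2 N) := by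
  rw [card_endFin_eq_card_bw, hvToBW_nb2]
  rfl

/-- **Madras–Slade Theorem 7.3.4 (c) on the honeycomb lattice, verbatim normalisation, NO hypotheses**:
`p_{2m+4}(ℍ)/p_{2m+2}(ℍ) → μ_ℍ² = 2 + √2`, where `p_N(ℍ) = hexPolygonCount N` counts the rooted oriented `N`-gons through the edge
`{0, e₀}` (the lane's HEX-SAP normalisation; `μ_polygon(ℍ) = μ_ℍ` is `tendsto_hexPolygonCount_rpow`). Printed and proved for `ℤ^d`
only; first text for `ℍ` (consolidation-grade: Kesten's mechanism, new lattice, closed form via Duminil-Copin–Smirnov).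
[cite: MadrasSlade1993, Theorem 7.3.4 (b)(c) (p. 248) and its proof (Lemma 7.3.1 p. 242, Cor 3.2.6 p. 68, Thm 7.3.2 (c) p. 244, Lemma 7.3.3 p. 247, (3.2.1) p. 63)]
[cite: Kesten1963SAW, §4] [cite: DuminilCopinSmirnov2012, Theorem 1] -/
theorem hexPolygonCountRatioTwo :
    Tendsto (fun m : ℕ => (hexPolygonCount (2 * m + 4) : ℝ) / hexPolygonCount (2 * m + 2)) atTop (𝓝 (2 + Real.sqrt 2)) := by
  have hnb2 : hvGraph.Adj hvOrigin nb2 := (adj_hvOrigin_iff nb2).2 (Or.inr (Or.inr rfl))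
  refine (hexPolygonRatioTwo hnb2).congr fun m => ?_
  rw [show 2 * m + 4 = (2 * m + 1 + 2) + 1 by ring, show 2 * m + 2 = (2 * m + 1) + 1 by ring,
    hexPolygonCount_eq_card_endFin, hexPolygonCount_eq_card_endFin]

/-- **The polygon upper RATE on `ℍ`, verbatim normalisation, NO hypotheses**: `p_{2m+4}(ℍ)/p_{2m+2}(ℍ) − (2+√2) ≤ K·m^{−1/4}` for all
large `m` (Kesten's exponent ¼; M–S (7.5.2) upper side). [cite: MadrasSlade1993, §7.5 eq. (7.5.2) p. 255 and Theorem 7.3.4 (c) p. 248]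
[cite: Kesten1963SAW, §4] [cite: DuminilCopinSmirnov2012, Theorem 1] -/
theorem hexPolygonCountRatioTwo_upperRate :
    ∃ K : ℝ, ∃ m₁ : ℕ, ∀ m : ℕ, m₁ ≤ m →
      (hexPolygonCount (2 * m + 4) : ℝ) / hexPolygonCount (2 * m + 2) - (2 + Real.sqrt 2) ≤ K * (m : ℝ) ^ (-(1 : ℝ) / 4) := by
  have hnb2 : hvGraph.Adj hvOrigin nb2 := (adj_hvOrigin_iff nb2).2 (Or.inr (Or.inr rfl))
  obtain ⟨K, m₁, h⟩ := hexPolygonRatioTwo_upperRate hnb2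
  refine ⟨K, m₁, fun m hm => ?_⟩
  rw [show 2 * m + 4 = (2 * m + 1 + 2) + 1 by ring, show 2 * m + 2 = (2 * m + 1) + 1 by ring,
    hexPolygonCount_eq_card_endFin, hexPolygonCount_eq_card_endFin]
  exact h m hm

end Literature.Probability.RandomPlanarGeometry.SAW.HV

end
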